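import Summits.Ventures.Crystal3D.Theorems.StickyWulffConstantTextureLiminfCubeRigidityLocalStacking
import HarnessLib

/-!
# TB-1 brick L-PROP: ADDITIVE LAYER PROPAGATION — Hales §1.3 locally, with a SLAB-CONE hypothesis (shells close-packed only near the layers being built)
# (lane T, crux `TextureLiminfV5`, stmt-Ventures-23912; memo HOME/wulff-p2/g25/SLAB-PLATES-g25.md §4 «the near-wall skin»)

HONEST FRAMING. Venture `Summits/Ventures/Crystal3D` (cell `crystal3d-full`), route `route-Ventures-StickyWulffConstant`, helper `--supports` the
law-v5 crux `TextureLiminfV5` (stmt-Ventures-23912).  A re-run (census-free, standard axioms) of `exists_local_stacking` ('…CubeRigidityLocalStacking', the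
layer-upon-layer recursion of the kernel proof of `CubeRigidity`) under a LOCAL hypothesis.  No cover is built; F-C1 not moved.

WHY.  The constructor of the healed `stub_TB_cover` must present grain `f`'s material BETWEEN its certified interior and the plates of its wall cells (memo
§4): the letters of the Barlow word there have to be READ from the near-wall material, layer by layer, and the reading must stop only at a real defect, not at
the `168×` halo of `ballRigidity`.  `exists_local_stacking` already reads layers additively (discs shrinking by `2` per layer) but asks for FCC/HCP tangent
arrangements at EVERY centre within `2n + 2` of the origin — a ball that contains the wall.  Its proof uses arrangements only at the NEIGHBOURS of the
layer balls it builds.  This file states and proves that local form: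

* `latPt_apply_two`, `apply_two_frameStep_up/_down` — heights: lattice points have height `0`, a layer step `τ w ± h e₃` changes the height by `± h`;
* **`exists_local_stacking_slab`** — base layer `LayerDisc V 0 σ σ' n`; FCC/HCP arrangements are asked only at centres `u ∈ V` with
  `|u 2 − m·h| ≤ 2` and `‖u‖ ≤ 2n − 2|m| + 2` for some level `|m| ≤ K₀` (the `2`-neighbourhood of the layers `|m| ≤ K₀` of the cone `|i| + |j| ≤ n − 2|m|`);
  conclusion: a Hägg word `s` with `barlowPos 2 h s k i j ∈ V` for all `|k| ≤ K₀ + 1`, `|i| + |j| ≤ n − 2|k|`.  So the certified layers reach to within ONE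
  layer of where the shells stop being close-packed, whatever lies beyond (a wall, a whisker top, another grain), and laterally the hypothesis region
  hugs the cone.
The frame transfer to a labelled packing `x : Fin N → E3` (doubling + isometry, as `mem_stacking_of_frame` / `ballRigidity`) and the one-sided variants are
the sequel; this file is the combinatorial core.
-/

noncomputable section

namespace Summit.Ventures.Crystal3D.Theorems.LocalStacking

open Literature.Geometry.DiscreteGeometry Literature.MathematicalPhysics.StatisticalMechanics
open RealInnerProductSpace Summit.Ventures.Crystal3D.L2B

variable {V : Set (EuclideanSpace ℝ (Fin 3))}

/-! ## Heights -/

/-- Lattice points of the standard layer have height `0`. -/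
@[simp] theorem latPt_apply_two (i j : ℤ) : latPt i j 2 = 0 := by
  simp [latPt, triangularVec₁, triangularVec₂]

/-- The offset `w` is horizontal. -/
@[simp] theorem barlowOffset_two_apply_two : (barlowOffset (2 : ℝ)) 2 = 0 := by
  simp [barlowOffset]

/-- The layer normal step has height `h`. -/
@[simp] theorem layerNormal_apply_two : (layerNormal layerSpacing) 2 = layerSpacing := by
  simp [layerNormal]

/-- An upward layer step raises the height by `h`. -/
theorem apply_two_frameStep_up (c : EuclideanSpace ℝ (Fin 3)) (τ : ℝ) :
    (c + (τ • barlowOffset (2 : ℝ) + layerNormal layerSpacing)) 2 = c 2 + layerSpacing := by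
  simp [PiLp.add_apply, PiLp.smul_apply]

/-- A downward layer step lowers the height by `h`. -/
theorem apply_two_frameStep_down (c : EuclideanSpace ℝ (Fin 3)) (τ : ℝ) :
    (c + (τ • barlowOffset (2 : ℝ) - layerNormal layerSpacing)) 2 = c 2 - layerSpacing := by
  simp [PiLp.add_apply, PiLp.smul_apply, sub_eq_add_neg]

/-! ## The local stacking under the slab-cone hypothesis -/

/-- **LAYER UPON LAYER, SLAB-LOCALLY.**  Base layer datum `LayerDisc V 0 σ σ' n`; FCC/HCP tangent arrangements only at the centres `u ∈ V` within height `2`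
of a level `m·h`, `|m| ≤ K₀`, and of norm `≤ 2n − 2|m| + 2`.  Then for a Hägg word `s` (the letters read off the packing) every site `(k, i, j)` with
`|k| ≤ K₀ + 1`, `|i| + |j| ≤ n − 2|k|` of `barlowStacking 2 h s` is a centre of `V`. -/
theorem exists_local_stacking_slab (hV : IsUnitBallPacking V) {σ σ' : ℝ} (hσ : σ = 1 ∨ σ = -1) (hσ' : σ' = 1 ∨ σ' = -1)
    {n : ℤ} (hL : LayerDisc V 0 σ σ' n) (K₀ : ℕ)
    (hcp : ∀ u ∈ V, ∀ m : ℤ, |m| ≤ K₀ → |u 2 - m * layerSpacing| ≤ 2 → ‖u‖ ≤ 2 * n - 2 * |m| + 2 →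
      IsArrangedIn (kissingShell V u) fccKissingPattern ∨ IsArrangedIn (kissingShell V u) hcpKissingPattern) :
    ∃ s : ℤ → ℤ, IsHaggSeq s ∧ ∀ k i j : ℤ, |k| ≤ K₀ + 1 → |i| + |j| ≤ n - 2 * |k| → barlowPos 2 layerSpacing s k i j ∈ V := by
  classical
  -- type detectors
  let upT : (EuclideanSpace ℝ (Fin 3)) → ℤ := fun c => if c + (barlowOffset (2 : ℝ) + layerNormal layerSpacing) ∈ V then 1 else -1
  let dnT : (EuclideanSpace ℝ (Fin 3)) → ℤ := fun c => if c + (barlowOffset (2 : ℝ) - layerNormal layerSpacing) ∈ V then 1 else -1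
  have upT_sign : ∀ c, ((upT c : ℤ) : ℝ) = 1 ∨ ((upT c : ℤ) : ℝ) = -1 := fun c => by
    simp only [upT]; split_ifs <;> simp
  have dnT_sign : ∀ c, ((dnT c : ℤ) : ℝ) = 1 ∨ ((dnT c : ℤ) : ℝ) = -1 := fun c => by
    simp only [dnT]; split_ifs <;> simp
  have upT_int : ∀ c, upT c = 1 ∨ upT c = -1 := fun c => by simp only [upT]; split_ifs <;> simp
  have dnT_int : ∀ c, dnT c = 1 ∨ dnT c = -1 := fun c => by simp only [dnT]; split_ifs <;> simp
  have upT_eq : ∀ {c : (EuclideanSpace ℝ (Fin 3))} {ρ ρ' : ℝ}, (ρ = 1 ∨ ρ = -1) → kissingShell V c = layerShell ρ ρ' →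
      ((upT c : ℤ) : ℝ) = ρ := by
    intro c ρ ρ' hρ h; rw [upper_type_eq hρ h]; simp only [upT]; split_ifs <;> simp
  have dnT_eq : ∀ {c : (EuclideanSpace ℝ (Fin 3))} {ρ ρ' : ℝ}, (ρ' = 1 ∨ ρ' = -1) → kissingShell V c = layerShell ρ ρ' →
      ((dnT c : ℤ) : ℝ) = ρ' := by
    intro c ρ ρ' hρ' h; rw [lower_type_eq hρ' h]; simp only [dnT]; split_ifs <;> simp
  -- arrangements near a base of controlled norm AND KNOWN HEIGHT `± m·h`, `m ≤ K₀` (the only place the hypothesis is used)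
  have cpAt : ∀ (c : (EuclideanSpace ℝ (Fin 3))) (m : ℕ) (ε : ℝ), (ε = 1 ∨ ε = -1) → (m : ℤ) ≤ K₀ → ‖c‖ ≤ 2 * m →
      c 2 = ε * (m * layerSpacing) → ∀ i j : ℤ, |i| + |j| ≤ n - 2 * m →
      ∀ y ∈ kissingShell V (c + latPt i j),
        IsArrangedIn (kissingShell V (c + latPt i j + y)) fccKissingPattern ∨
          IsArrangedIn (kissingShell V (c + latPt i j + y)) hcpKissingPattern := by
    intro c m ε hε hm hc hc2 i j hij y hy
    have hm' : |((if ε = 1 then (m : ℤ) else -(m : ℤ)) : ℤ)| ≤ K₀ := by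
      split_ifs <;> simp [abs_of_nonneg (Int.natCast_nonneg m)] <;> exact_mod_cast hm
    refine hcp _ hy.1 (if ε = 1 then (m : ℤ) else -(m : ℤ)) hm' ?_ ?_
    · -- height
      have hy2 : |y 2| ≤ 2 := by
        rw [← hy.2]
        have := PiLp.norm_apply_le y 2
        rwa [Real.norm_eq_abs] at this
      have e : (c + latPt i j + y) 2 - (((if ε = 1 then (m : ℤ) else -(m : ℤ)) : ℤ) : ℝ) * layerSpacing = y 2 := by
        rw [PiLp.add_apply, PiLp.add_apply, latPt_apply_two, hc2]
        rcases hε with rfl | rfl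
        · simp
        · rw [if_neg (by norm_num)]; push_cast; ring
      rw [e]; exact hy2
    · -- norm
      have hij' : ((|i| + |j| : ℤ) : ℝ) ≤ n - 2 * m := by exact_mod_cast hij
      have habs : ((|((if ε = 1 then (m : ℤ) else -(m : ℤ)) : ℤ)| : ℤ) : ℝ) = m := by
        split_ifs <;> simp [abs_of_nonneg (Int.natCast_nonneg m)]
      rw [habs]
      calc ‖c + latPt i j + y‖ ≤ ‖c‖ + ‖latPt i j‖ + ‖y‖ := norm_add₃_le
        _ ≤ 2 * m + 2 * (|i| + |j| : ℤ) + 2 := by rw [hy.2]; linarith [norm_latPt_le i j]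
        _ ≤ 2 * n - 2 * m + 2 := by linarith
  -- the bases, upwards and downwards
  let bup : ℕ → (EuclideanSpace ℝ (Fin 3)) := fun m => Nat.rec (motive := fun _ => (EuclideanSpace ℝ (Fin 3))) 0
    (fun _ b => b + (((upT b : ℤ) : ℝ) • barlowOffset (2 : ℝ) + layerNormal layerSpacing)) m
  let bdn : ℕ → (EuclideanSpace ℝ (Fin 3)) := fun m => Nat.rec (motive := fun _ => (EuclideanSpace ℝ (Fin 3))) 0
    (fun _ b => b + (((dnT b : ℤ) : ℝ) • barlowOffset (2 : ℝ) - layerNormal layerSpacing)) m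
  have bup_zero : bup 0 = 0 := rfl
  have bdn_zero : bdn 0 = 0 := rfl
  have bup_succ : ∀ m, bup (m + 1) = bup m + (((upT (bup m) : ℤ) : ℝ) • barlowOffset (2 : ℝ) + layerNormal layerSpacing) := fun m => rfl
  have bdn_succ : ∀ m, bdn (m + 1) = bdn m + (((dnT (bdn m) : ℤ) : ℝ) • barlowOffset (2 : ℝ) - layerNormal layerSpacing) := fun m => rfl
  have norm_bup : ∀ m : ℕ, ‖bup m‖ ≤ 2 * m := by
    intro m
    induction m with
    | zero => simp [bup_zero]
    | succ m ih =>
      rw [bup_succ]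
      calc ‖bup m + (((upT (bup m) : ℤ) : ℝ) • barlowOffset (2 : ℝ) + layerNormal layerSpacing)‖
            ≤ ‖bup m‖ + ‖((upT (bup m) : ℤ) : ℝ) • (barlowOffset (2 : ℝ)) + layerNormal layerSpacing‖ := norm_add_le _ _
        _ ≤ 2 * m + 2 := by rw [norm_sign_smul_frameW_add_frameE (upT_sign _)]; linarith
        _ = 2 * (m + 1 : ℕ) := by push_cast; ring
  have norm_bdn : ∀ m : ℕ, ‖bdn m‖ ≤ 2 * m := by
    intro m
    induction m with
    | zero => simp [bdn_zero]
    | succ m ih =>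
      rw [bdn_succ]
      calc ‖bdn m + (((dnT (bdn m) : ℤ) : ℝ) • barlowOffset (2 : ℝ) - layerNormal layerSpacing)‖
            ≤ ‖bdn m‖ + ‖((dnT (bdn m) : ℤ) : ℝ) • (barlowOffset (2 : ℝ)) - layerNormal layerSpacing‖ := norm_add_le _ _
        _ ≤ 2 * m + 2 := by rw [norm_sign_smul_frameW_sub_frameE (dnT_sign _)]; linarith
        _ = 2 * (m + 1 : ℕ) := by push_cast; ring
  -- NEW: the heights of the bases
  have two_bup : ∀ m : ℕ, (bup m) 2 = 1 * (m * layerSpacing) := by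
    intro m
    induction m with
    | zero => simp [bup_zero]
    | succ m ih => rw [bup_succ, apply_two_frameStep_up, ih]; push_cast; ring
  have two_bdn : ∀ m : ℕ, (bdn m) 2 = -1 * (m * layerSpacing) := by
    intro m
    induction m with
    | zero => simp [bdn_zero]
    | succ m ih => rw [bdn_succ, apply_two_frameStep_down, ih]; push_cast; ring
  -- the invariants, up to level `K₀ + 1`
  have inv_up : ∀ m : ℕ, (m : ℤ) ≤ K₀ + 1 →
      ∃ τ' : ℝ, (τ' = 1 ∨ τ' = -1) ∧ LayerDisc V (bup m) ((upT (bup m) : ℤ) : ℝ) τ' (n - 2 * m) := by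
    intro m
    induction m with
    | zero =>
      intro _
      refine ⟨σ', hσ', ?_⟩
      by_cases hn : (0 : ℤ) ≤ n
      · have e : ((upT 0 : ℤ) : ℝ) = σ := upT_eq hσ (by simpa using (hL 0 0 (by simpa using hn)).2)
        rw [bup_zero, e]; simpa using hL
      · intro i j hij; exfalso; have := abs_nonneg i; have := abs_nonneg j; push_cast at hij; omega
    | succ m ih =>
      intro hm
      have hmK : (m : ℤ) ≤ K₀ := by push_cast at hm; omega
      obtain ⟨τ', hτ', hD⟩ := ih (by omega)
      obtain ⟨ρ, hρ, hD'⟩ := layerDisc_up hV (upT_sign (bup m)) hD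
        (cpAt (bup m) m 1 (Or.inl rfl) hmK (norm_bup m) (two_bup m))
      rw [← bup_succ] at hD'
      have e2 : n - 2 * (m : ℕ) - 2 = n - 2 * ((m + 1 : ℕ) : ℤ) := by push_cast; ring
      rw [e2] at hD'
      refine ⟨-((upT (bup m) : ℤ) : ℝ), by rcases upT_sign (bup m) with h | h <;> rw [h] <;> norm_num, ?_⟩
      by_cases hn : (0 : ℤ) ≤ n - 2 * ((m + 1 : ℕ) : ℤ)
      · have e : ((upT (bup (m + 1)) : ℤ) : ℝ) = ρ := upT_eq hρ (by simpa using (hD' 0 0 (by simpa using hn)).2)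
        rwa [e]
      · intro i j hij; exfalso; have := abs_nonneg i; have := abs_nonneg j; omega
  have inv_dn : ∀ m : ℕ, (m : ℤ) ≤ K₀ + 1 →
      ∃ τ : ℝ, (τ = 1 ∨ τ = -1) ∧ LayerDisc V (bdn m) τ ((dnT (bdn m) : ℤ) : ℝ) (n - 2 * m) := by
    intro m
    induction m with
    | zero =>
      intro _
      refine ⟨σ, hσ, ?_⟩
      by_cases hn : (0 : ℤ) ≤ n
      · have e : ((dnT 0 : ℤ) : ℝ) = σ' := dnT_eq hσ' (by simpa using (hL 0 0 (by simpa using hn)).2)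
        rw [bdn_zero, e]; simpa using hL
      · intro i j hij; exfalso; have := abs_nonneg i; have := abs_nonneg j; push_cast at hij; omega
    | succ m ih =>
      intro hm
      have hmK : (m : ℤ) ≤ K₀ := by push_cast at hm; omega
      obtain ⟨τ, hτ, hD⟩ := ih (by omega)
      obtain ⟨ρ', hρ', hD'⟩ := layerDisc_down hV (dnT_sign (bdn m)) hD
        (cpAt (bdn m) m (-1) (Or.inr rfl) hmK (norm_bdn m) (two_bdn m))
      rw [← bdn_succ] at hD'
      have e2 : n - 2 * (m : ℕ) - 2 = n - 2 * ((m + 1 : ℕ) : ℤ) := by push_cast; ring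
      rw [e2] at hD'
      refine ⟨-((dnT (bdn m) : ℤ) : ℝ), by rcases dnT_sign (bdn m) with h | h <;> rw [h] <;> norm_num, ?_⟩
      by_cases hn : (0 : ℤ) ≤ n - 2 * ((m + 1 : ℕ) : ℤ)
      · have e : ((dnT (bdn (m + 1)) : ℤ) : ℝ) = ρ' := dnT_eq hρ' (by simpa using (hD' 0 0 (by simpa using hn)).2)
        rwa [e]
      · intro i j hij; exfalso; have := abs_nonneg i; have := abs_nonneg j; omega
  -- the Hägg word
  let sq : ℤ → ℤ := fun k => if 0 ≤ k then upT (bup k.toNat) else -dnT (bdn (-k - 1).toNat)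
  have hsq : IsHaggSeq sq := by
    intro k
    by_cases hk : 0 ≤ k
    · simp only [sq, if_pos hk]; exact upT_int _
    · simp only [sq, if_neg hk]; rcases dnT_int (bdn (-k - 1).toNat) with h | h <;> rw [h] <;> norm_num
  have sq_nat : ∀ m : ℕ, sq m = upT (bup m) := fun m => by
    simp only [sq, if_pos (Int.natCast_nonneg m), Int.toNat_natCast]
  have sq_neg : ∀ m : ℕ, sq (-((m : ℤ) + 1)) = -dnT (bdn m) := fun m => by
    have h1 : ¬ (0 : ℤ) ≤ -((m : ℤ) + 1) := by omega
    have h2 : (-(-((m : ℤ) + 1)) - 1).toNat = m := by simp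
    simp only [sq, if_neg h1, h2]
  -- positions of the bases
  have up_pos : ∀ m : ℕ, bup m = (haggLabel sq m : ℝ) • (barlowOffset (2 : ℝ)) + ((m : ℤ) : ℝ) • layerNormal layerSpacing := by
    intro m
    induction m with
    | zero => simp [bup_zero]
    | succ m ih =>
      rw [bup_succ]
      set ν := upT (bup m) with hν
      rw [ih, Nat.cast_succ, haggLabel_succ, sq_nat m, ← hν]
      push_cast
      module
  have dn_pos : ∀ m : ℕ, bdn m = (haggLabel sq (-(m : ℤ)) : ℝ) • (barlowOffset (2 : ℝ)) + ((-(m : ℤ) : ℤ) : ℝ) • layerNormal layerSpacing := by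
    intro m
    induction m with
    | zero => simp [bdn_zero]
    | succ m ih =>
      have hrec : haggLabel sq (-(m : ℤ)) = haggLabel sq (-((m : ℤ) + 1)) + sq (-((m : ℤ) + 1)) := by
        have := haggLabel_succ sq (-((m : ℤ) + 1))
        rwa [show -((m : ℤ) + 1) + 1 = -(m : ℤ) by ring] at this
      rw [bdn_succ]
      set ν := dnT (bdn m) with hν
      rw [ih]
      have e : (haggLabel sq (-((m + 1 : ℕ) : ℤ)) : ℝ) = haggLabel sq (-(m : ℤ)) + ν := by
        rw [Nat.cast_succ, hrec, sq_neg m, ← hν]; push_cast; ring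
      rw [e]
      push_cast
      module
  -- conclusion
  refine ⟨sq, hsq, fun k i j hkK hk => ?_⟩
  rcases le_or_gt 0 k with hk0 | hk0
  · obtain ⟨m, rfl⟩ := Int.eq_ofNat_of_zero_le hk0
    have hmK : ((m : ℕ) : ℤ) ≤ K₀ + 1 := by rwa [abs_of_nonneg hk0] at hkK
    obtain ⟨τ', -, hD⟩ := inv_up m hmK
    have h := (hD i j (by rwa [abs_of_nonneg hk0] at hk)).1
    rw [up_pos m] at h
    rw [barlowPos_eq_latPt, add_comm]
    exact h
  · obtain ⟨m, rfl⟩ : ∃ m : ℕ, k = -((m : ℤ) + 1) := ⟨(-k - 1).toNat, by omega⟩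
    have hmK : ((m + 1 : ℕ) : ℤ) ≤ K₀ + 1 := by
      rw [abs_of_neg hk0] at hkK; push_cast at hkK ⊢; linarith
    obtain ⟨τ, -, hD⟩ := inv_dn (m + 1) hmK
    have hk' : |i| + |j| ≤ n - 2 * ((m + 1 : ℕ) : ℤ) := by
      rw [abs_of_neg hk0] at hk; push_cast at hk ⊢; linarith
    have h := (hD i j hk').1
    rw [dn_pos (m + 1)] at h
    rw [barlowPos_eq_latPt, add_comm]
    convert h using 3 <;> push_cast <;> ring_nf

end Summit.Ventures.Crystal3D.Theorems.LocalStacking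

end
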